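import Literature.NumberTheory.Sieve.QuadraticRootsPrimeModuliDFISmoothing
import Mathlib.Analysis.Calculus.ContDiff.Bounds
import Mathlib.Topology.Order.Compact
import HarnessLib

/-!
# S3-CUT: a SMOOTH small-field window cut with `P`-UNIFORM derivative tables — `χ_P t := smoothTransition (P − t) · smoothTransition (P + t)` is `C^∞`, `= 1` on `|t| ≤ P − 1`,
# `= 0` on `P ≤ |t|`, `0 ≤ χ_P ≤ 1`, and `∃ c : ℕ → ℝ` NOT depending on `P` with `‖Dⁿ χ_P t‖ ≤ c n` for all `n P t`

Cell `ym3-torus` (YM ladder rung R3 = continuum `SU(2)` Yang–Mills on the three-torus — a RUNG, NOT d = 4, NOT infinite volume, NOT a mass gap, NOT Clay).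
Width seat `ym3-torus-px20` (gen 16); `--supports stmt-QuantumFields-20520 --as helper`, count-neutral, definition-free, default heartbeats; registry v11.4 №36
untouched.  BLUEPRINT-ECE₁ (P→R-3′) (evidence on stmt-QuantumFields-20520, px20 g15): GREP (✓`AnchorGap.stub_gaussianBBFPolymerRep`) and GBND∕(GB-an) ask `ContDiff ℝ ⊤` atom
factors with derivative tables, while the small-field cut of the one-step weight is SHARP (`1_{histGood}`) or Lipschitz (O1 v17.2's clipped ramps `sfCut`); whichever exit v18 takes
(smooth cut at the fluctuation level, the sharp∕smooth difference going to the large-field side, or a large-field split first) needs a `C^∞` cut at radius `P = p(g_J)` whose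
tables do NOT grow with `P`.  This file supplies it, Mathlib-only, with no new letter (the cut is an explicit product of Mathlib's `Real.smoothTransition`):
* §1 the jets of `Real.smoothTransition`: orders `≥ 1` vanish off `[0,1]` (lit ✓`DFI1995.iteratedDeriv_smoothTransition_of_neg` ∕ `…_of_one_lt`, BY NAME — the tree's
  Duke–Friedlander–Iwaniec smoothing file already has them; its `plateau` bounds stop at order `4`), ★`exists_bound_iteratedDeriv_smoothTransition` (`∃ c ≥ 0, ∀ t,
  ‖Dⁿ smoothTransition t‖ ≤ c` for EVERY `n`, compactness of `[0,1]`).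
* §2 the cut: `cut_contDiff`, `cut_nonneg`, `cut_le_one`, `cut_eq_one` (`|t| ≤ P − 1`), `cut_eq_zero` (`P ≤ |t|`), the one-sided jets `norm_iteratedDeriv_comp_const_sub_le` ∕
  `norm_iteratedDeriv_comp_const_add_le` (translation∕reflection invariance of the tables, Mathlib `iteratedDeriv_comp_const_sub`∕`iteratedDeriv_comp_const_add`).
* §3 ★★`exists_uniform_iteratedDeriv_cut_bound` — `∃ c : ℕ → ℝ, (∀ n, 0 ≤ c n) ∧ ∀ n P t, ‖iteratedDeriv n (fun t => smoothTransition (P − t) * smoothTransition (P + t)) t‖ ≤ c n`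
  (Leibniz `norm_iteratedFDeriv_mul_le` + §1); `iteratedDeriv_cut_eq_zero_of_lt` ∕ `…_of_gt` (orders `≥ 1` live on the EDGE `P − 1 ≤ |t| ≤ P` only — where the Gaussian weight is
  `e^{−(P−1)²∕2}`-small: the cut-derivative terms of the expansion are large-field-small).

HONEST SCOPE.  [folklore] calculus of a bump function; a SUPPLY theorem — it decides nothing about v18's cut design, introduces no `sfCut`-type letter, and proves nothing of GREP's
assembly, of the large-field side, of Bałaban's expansions, of GAS∕GAS₁∕REP∕H4ᶜ∕S2β or of `FluctuationComparisonRegPrIntL` (stmt-QuantumFields-20520); no summit statement is proved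
by a helper; rung R3 = SU(2) YM₃ on T³ — NOT d = 4, NOT infinite volume, NOT a mass gap, NOT Clay; the Yang–Mills mass gap is NOT proved.

References: T. Bałaban, CMP **122** (1989) 355–392 [Balaban1989LargeFieldII] (§1, smooth characteristic functions of the small-field regions); D. C. Brydges, Les Houches 1984
[Brydges1986] §3; T. Bałaban, CMP **102** (1985) 255–275 [Balaban1985UV3] ((22), the `χ` inside the fluctuation integral).
-/

set_option autoImplicit false

noncomputable section

open Set Filter Topology

namespace Summit.QuantumFields.YangMills.Theorems.LoopLedgerSmoothCut

open Literature.NumberTheory.Sieve.DFI1995 (iteratedDeriv_smoothTransition_of_neg iteratedDeriv_smoothTransition_of_one_lt)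

/-! ## §1 The jets of `Real.smoothTransition` -/

/-- ★ every derivative of `smoothTransition` is bounded on `ℝ` (continuous on the compact `[0,1]`, zero∕bounded outside). [folklore] -/
theorem exists_bound_iteratedDeriv_smoothTransition (n : ℕ) :
    ∃ c : ℝ, 0 ≤ c ∧ ∀ t : ℝ, ‖iteratedDeriv n Real.smoothTransition t‖ ≤ c := by
  have hcont : Continuous (iteratedDeriv n Real.smoothTransition) :=
    Real.smoothTransition.contDiff.continuous_iteratedDeriv n (by exact_mod_cast le_top)
  obtain ⟨c, hc⟩ := isCompact_Icc.exists_bound_of_continuousOn (hcont.norm.continuousOn (s := Icc (0 : ℝ) 1))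
  refine ⟨max c 1, le_max_of_le_right zero_le_one, fun t => ?_⟩
  by_cases ht : t ∈ Icc (0 : ℝ) 1
  · have h := hc t ht
    rw [norm_norm] at h
    exact h.trans (le_max_left _ _)
  · rw [mem_Icc, not_and_or, not_le, not_le] at ht
    rcases Nat.eq_zero_or_pos n with hn | hn
    · subst hn
      rw [iteratedDeriv_zero, Real.norm_eq_abs, abs_of_nonneg (Real.smoothTransition.nonneg t)]
      exact (Real.smoothTransition.le_one t).trans (le_max_right _ _)
    · rcases ht with ht | ht
      · rw [iteratedDeriv_smoothTransition_of_neg hn.ne' ht, norm_zero]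
        exact le_trans zero_le_one (le_max_right _ _)
      · rw [iteratedDeriv_smoothTransition_of_one_lt hn.ne' ht, norm_zero]
        exact le_trans zero_le_one (le_max_right _ _)

/-! ## §2 The cut `χ_P t = smoothTransition (P − t) · smoothTransition (P + t)` -/

/-- the cut is `C^∞`. [folklore] -/
theorem cut_contDiff (P : ℝ) {N : ℕ∞} :
    ContDiff ℝ N (fun t : ℝ => Real.smoothTransition (P - t) * Real.smoothTransition (P + t)) := by
  have hf : ContDiff ℝ N (fun s : ℝ => Real.smoothTransition (P - s)) :=
    Real.smoothTransition.contDiff.comp (contDiff_const.sub contDiff_id)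
  have hg : ContDiff ℝ N (fun s : ℝ => Real.smoothTransition (P + s)) :=
    Real.smoothTransition.contDiff.comp (contDiff_const.add contDiff_id)
  exact hf.mul hg

/-- `0 ≤ χ_P`. [folklore] -/
theorem cut_nonneg (P t : ℝ) : 0 ≤ Real.smoothTransition (P - t) * Real.smoothTransition (P + t) :=
  mul_nonneg (Real.smoothTransition.nonneg _) (Real.smoothTransition.nonneg _)

/-- `χ_P ≤ 1`. [folklore] -/
theorem cut_le_one (P t : ℝ) : Real.smoothTransition (P - t) * Real.smoothTransition (P + t) ≤ 1 :=
  mul_le_one₀ (Real.smoothTransition.le_one _) (Real.smoothTransition.nonneg _) (Real.smoothTransition.le_one _)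

/-- `χ_P = 1` on the inner window `|t| ≤ P − 1`. [folklore] -/
theorem cut_eq_one {P t : ℝ} (ht : |t| ≤ P - 1) : Real.smoothTransition (P - t) * Real.smoothTransition (P + t) = 1 := by
  rw [abs_le] at ht
  rw [Real.smoothTransition.one_of_one_le (by linarith), Real.smoothTransition.one_of_one_le (by linarith), one_mul]

/-- `χ_P = 0` outside the window, `P ≤ |t|`. [folklore] -/
theorem cut_eq_zero {P t : ℝ} (ht : P ≤ |t|) : Real.smoothTransition (P - t) * Real.smoothTransition (P + t) = 0 := by
  rcases le_abs'.1 ht with h | h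
  · rw [Real.smoothTransition.zero_of_nonpos (by linarith : P + t ≤ 0), mul_zero]
  · rw [Real.smoothTransition.zero_of_nonpos (by linarith : P - t ≤ 0), zero_mul]

/-- the jets of the reflected∕translated factor `t ↦ f (P − t)` have the same norms as those of `f`. [folklore] -/
theorem norm_iteratedDeriv_comp_const_sub (f : ℝ → ℝ) (n : ℕ) (P t : ℝ) :
    ‖iteratedDeriv n (fun s => f (P - s)) t‖ = ‖iteratedDeriv n f (P - t)‖ := by
  rw [iteratedDeriv_comp_const_sub]
  simp only [norm_smul, norm_pow, norm_neg, norm_one, one_pow, one_mul]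

/-- the jets of the translated factor `t ↦ f (P + t)` have the same norms as those of `f`. [folklore] -/
theorem norm_iteratedDeriv_comp_const_add (f : ℝ → ℝ) (n : ℕ) (P t : ℝ) :
    ‖iteratedDeriv n (fun s => f (P + s)) t‖ = ‖iteratedDeriv n f (P + t)‖ := by
  rw [iteratedDeriv_comp_const_add]

/-! ## §3 The `P`-uniform table -/

/-- ★★ **THE `P`-UNIFORM TABLE.**  There is `c : ℕ → ℝ`, `c ≥ 0`, NOT depending on the radius `P`, with `‖Dⁿ χ_P (t)‖ ≤ c n` for every `n`, `P`, `t` — Leibniz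
(Mathlib `norm_iteratedFDeriv_mul_le`) over §1's bounds for the two factors, whose jets are translates∕reflections of `smoothTransition`'s. [folklore] -/
theorem exists_uniform_iteratedDeriv_cut_bound :
    ∃ c : ℕ → ℝ, (∀ n, 0 ≤ c n) ∧
      ∀ (n : ℕ) (P t : ℝ), ‖iteratedDeriv n (fun s : ℝ => Real.smoothTransition (P - s) * Real.smoothTransition (P + s)) t‖ ≤ c n := by
  choose b hb0 hb using exists_bound_iteratedDeriv_smoothTransition
  refine ⟨fun n => ∑ i ∈ Finset.range (n + 1), (n.choose i : ℝ) * b i * b (n - i), fun n => ?_, fun n P t => ?_⟩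
  · exact Finset.sum_nonneg fun i _ => mul_nonneg (mul_nonneg (Nat.cast_nonneg _) (hb0 i)) (hb0 _)
  have hf : ContDiff ℝ ((⊤ : ℕ∞) : WithTop ℕ∞) (fun s : ℝ => Real.smoothTransition (P - s)) :=
    Real.smoothTransition.contDiff.comp (contDiff_const.sub contDiff_id)
  have hg : ContDiff ℝ ((⊤ : ℕ∞) : WithTop ℕ∞) (fun s : ℝ => Real.smoothTransition (P + s)) :=
    Real.smoothTransition.contDiff.comp (contDiff_const.add contDiff_id)
  rw [← norm_iteratedFDeriv_eq_norm_iteratedDeriv]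
  refine (norm_iteratedFDeriv_mul_le hf hg t (n := n) (by exact_mod_cast le_top)).trans (Finset.sum_le_sum fun i _ => ?_)
  rw [norm_iteratedFDeriv_eq_norm_iteratedDeriv, norm_iteratedFDeriv_eq_norm_iteratedDeriv, norm_iteratedDeriv_comp_const_sub,
    norm_iteratedDeriv_comp_const_add, mul_assoc, mul_assoc]
  exact mul_le_mul_of_nonneg_left (mul_le_mul (hb i _) (hb (n - i) _) (norm_nonneg _) (hb0 i)) (Nat.cast_nonneg _)

/-- inside the inner window (`|t| < P − 1`) the cut is locally `1`, so its derivatives of order `≥ 1` vanish there. [folklore] -/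
theorem iteratedDeriv_cut_eq_zero_of_lt {n : ℕ} (hn : n ≠ 0) {P t : ℝ} (ht : |t| < P - 1) :
    iteratedDeriv n (fun s : ℝ => Real.smoothTransition (P - s) * Real.smoothTransition (P + s)) t = 0 := by
  have h : (fun s : ℝ => Real.smoothTransition (P - s) * Real.smoothTransition (P + s)) =ᶠ[𝓝 t] fun _ => (1 : ℝ) := by
    have ho : IsOpen {s : ℝ | |s| < P - 1} := isOpen_lt continuous_abs continuous_const
    filter_upwards [ho.mem_nhds ht] with s hs
    exact cut_eq_one (le_of_lt hs)
  rw [(h.iteratedDeriv n).self_of_nhds, iteratedDeriv_const, if_neg hn]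

/-- outside the window (`P < |t|`) the cut is locally `0`, so its derivatives of order `≥ 1` (indeed all orders) vanish there. [folklore] -/
theorem iteratedDeriv_cut_eq_zero_of_gt (n : ℕ) {P t : ℝ} (ht : P < |t|) :
    iteratedDeriv n (fun s : ℝ => Real.smoothTransition (P - s) * Real.smoothTransition (P + s)) t = 0 := by
  have h : (fun s : ℝ => Real.smoothTransition (P - s) * Real.smoothTransition (P + s)) =ᶠ[𝓝 t] fun _ => (0 : ℝ) := by
    have ho : IsOpen {s : ℝ | P < |s|} := isOpen_lt continuous_const continuous_abs
    filter_upwards [ho.mem_nhds ht] with s hs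
    exact cut_eq_zero (le_of_lt hs)
  rw [(h.iteratedDeriv n).self_of_nhds, iteratedDeriv_const]
  split_ifs <;> rfl

end Summit.QuantumFields.YangMills.Theorems.LoopLedgerSmoothCut

end
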